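import Literature.AlgebraicGeometry.AbelianSchemes.PolarizedTripleIsBaseChangeViaZariskiLocal
import Literature.AlgebraicGeometry.AbelianSchemes.RigidifiedTrivialFpqcDescentQuasiCompact
import Literature.AlgebraicGeometry.Morphisms.FpqcDescentOfMorphisms
import Mathlib.AlgebraicGeometry.Morphisms.FlatDescent
import HarnessLib

/-!
# The pull-back relation of polarised abelian schemes with level structure is fpqc-local on the base

Layer `Literature/AlgebraicGeometry/AbelianSchemes`, namespaces `Literature.AlgebraicGeometry.AbelianSchemes.AbelianSchemeOver`,
`…AbelianSchemeOver.LevelStructure`, `…PolarizedAbelianSchemeWithLevel`.  THEOREMS ONLY (no definition, no structure, no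
instance, no named fact, no `sorry`).  Cell `hodgecm-mathlib` (D-0151), F-DAG hand (h7) sequel (P3) — the fpqc twin of ★
`PolarizedTripleIsBaseChangeViaZariskiLocal` — and the generic core of F-10 (b2′) «the relation `Y.IsBaseChangeVia X_Q f G Ĝ`
for the descended classifying map» (consumers: (b2′)/(b3)/(pack) of `SiegelFineModuliScheme…Quotient…`).  HC_CM is proved
only modulo the 7 printed citations until rung 0 closes; nothing here is about HC.

[MumfordFogartyKirwan1994, Ch. 7 §2 Definition 7.2 (p. 129)] records pull-back of triples `(X, λ, σ)` as the relation ★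
`PolarizedAbelianSchemeWithLevel.IsBaseChangeVia P' P f G Ĝ`; [GortzWedhorn2020, Thm. 14.72] / [StacksProject, Tag 023Q]:
morphisms of schemes (and their equalities) descend along fpqc coverings, and «isomorphism» is an fpqc-local property
(Mathlib `descendsAlong_isomorphisms_surjective_inf_flat_inf_quasicompact`, [StacksProject, Tag 02L4]).  THIS FILE: for
`c : T' → T` flat, surjective and quasi-compact, if the restricted triple `P'|_{T'}` (★ `baseChange c`) is the pull-back
of `P` along `T' → T → S` via the restricted maps `(X' ×_T T' → X') ≫ G`, `(X̂' ×_T T' → X̂') ≫ Ĝ`, then `P'` is the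
pull-back of `P` along `f` via `(G, Ĝ)`.

* §1 `AbelianSchemeOver.hom_ext_pullback_of_flat_surjective` — `Over.pullback c` is faithful for `c` fpqc (the base change
  `X ×_T T' → X` of `c` is an epimorphism, Mathlib `Sites/Fpqc`); `AbelianSchemeOver.isMonHom_of_flat_surjective` — being
  a homomorphism is fpqc-local on the base (the proof of ★ `isMonHom_of_openCover` verbatim, [GortzWedhorn2020] (4.15));
  `AbelianSchemeOver.isPullback_of_flat_surjective` — a square over `T → S` is cartesian if it is so after the base
  change `T' → T` (the comparison `X' → X ×_S T` is an isomorphism fpqc-locally on its target);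
  **`AbelianSchemeOver.isBaseChangeVia_of_flat_surjective`** — the group-scheme relation is fpqc-local on `T`.
* §2 `AbelianSchemeOver.LevelStructure.isBaseChangeVia_of_flat_surjective` (sections: `c` is an epimorphism, ★
  `hom_ext_of_fpqc`).
* §3 **`PolarizedAbelianSchemeWithLevel.isBaseChangeVia_of_flat_surjective`** (`T` locally Noetherian): `λ`-clause after
  the epimorphism `X' ×_T T' → X'`; POINCARÉ clause by the rigidified fpqc descent ★ (u6b)
  `RigidifiedLineBundle.nonempty_iso_of_pullback_prodMap_of_quasiCompact` on `X'_{X̂'}` along `X̂' ×_T T' → X̂'` (the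
  bookkeeping lemmas of ★ ed. 1 `exists_comp_prodBaseChangeToProd_eq_prodMap`, `prodBaseChangeToProd_comp_pullback_map`,
  `nonempty_pullback_unitSection_pullback_map_P_iso` apply verbatim with `Uᵢ ↦ T'`).

## References
* [MumfordFogartyKirwan1994] D. Mumford, J. Fogarty, F. Kirwan, *Geometric Invariant Theory*, 3rd ed. (1994), Ch. 7 §2
  Definition 7.2 (p. 129); Proposition 7.6 (pp. 136–138).
* [GortzWedhorn2020] U. Görtz, T. Wedhorn, *Algebraic Geometry I*, 2nd ed. (2020), Thm. 14.72 (fpqc descent of morphisms),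
  Section (4.15) (p. 116), Prop. 4.16 (p. 101).
* [StacksProject] The Stacks project, Tag 023Q (Descent, Lemma 35.13.7), Tag 02L4 (Descent, Lemma 35.23.19: isomorphism is
  fpqc local on the base).
* [MumfordAV1970] D. Mumford, *Abelian Varieties* (1970), §13 (p. 125), §15 Thm. 1 (p. 143).
-/

noncomputable section

-- `Scheme.Modules` / `SheafOfModules` and the `Over`-category structure maps are not reducible (as in ★ ed. 1).
set_option backward.isDefEq.respectTransparency false

universe u

open CategoryTheory CategoryTheory.Limits AlgebraicGeometry MonoidalCategory CartesianMonoidalCategory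
open scoped MonObj CategoryTheory.Obj

namespace Literature.AlgebraicGeometry.AbelianSchemes

open Literature.AlgebraicGeometry.Morphisms

namespace AbelianSchemeOver

variable {S T T' : Scheme.{u}} (c : T' ⟶ T) [Flat c] [Surjective c] [QuasiCompact c]

/-! ### §1 The group-scheme relation is fpqc-local on `T` -/

/-- **`Over.pullback c` is faithful for an fpqc covering `c : T' → T`**: two `T`-morphisms `u v : X → Y` with
`u ×_T T' = v ×_T T'` are equal — they agree after the base change `X ×_T T' → X` of `c`, a flat surjective
quasi-compact morphism, hence an epimorphism (Mathlib `Sites/Fpqc`). [cite: GortzWedhorn2020, Thm. 14.72]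
[cite: StacksProject, Tag 023Q (Descent, Lemma 35.13.7)] -/
theorem hom_ext_pullback_of_flat_surjective {X Y : Over T} (u v : X ⟶ Y)
    (h : (Over.pullback c).map u = (Over.pullback c).map v) : u = v := by
  ext
  rw [← cancel_epi (pullback.fst X.hom c)]
  have e := congrArg (fun w => w.left ≫ pullback.fst Y.hom c) h
  simp only [Over.pullback_map_left] at e
  erw [pullback.lift_fst, pullback.lift_fst] at e
  exact e

/-- **Being a homomorphism of group schemes is fpqc-local on the base**: if the base change
`Λ ×_T T' : A ×_T T' → B ×_T T'` along an fpqc covering `c : T' → T` is a homomorphism (for the transported group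
structures, ★ `AbelianSchemeOver.baseChange`), then so is `Λ` — the unit and multiplication clauses are tested after the
faithful monoidal functor `Over.pullback c` (`hom_ext_pullback_of_flat_surjective`), whose structure isomorphisms cancel
(the proof of ★ `isMonHom_of_openCover`). [cite: GortzWedhorn2020, Section (4.15) (p. 116) and Definition 4.42 (p. 116)]
[cite: GortzWedhorn2020, Thm. 14.72] -/
theorem isMonHom_of_flat_surjective (A B : AbelianSchemeOver T) (Λ : A.X ⟶ B.X)
    (h : IsMonHom ((Over.pullback c).map Λ : (A.baseChange c).X ⟶ (B.baseChange c).X)) : IsMonHom Λ where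
  one_hom := by
    refine hom_ext_pullback_of_flat_surjective c _ _ ?_
    have e := h.one_hom
    rw [Functor.obj.η_def, Functor.obj.η_def, Category.assoc, ← Functor.map_comp] at e
    exact (cancel_epi _).mp e
  mul_hom := by
    refine hom_ext_pullback_of_flat_surjective c _ _ ?_
    have e := h.mul_hom
    rw [Functor.obj.μ_def, Functor.obj.μ_def, Category.assoc, Functor.LaxMonoidal.μ_natural_assoc,
      ← Functor.map_comp, ← Functor.map_comp] at e
    exact (cancel_epi _).mp e

variable {A' : AbelianSchemeOver T} {A : AbelianSchemeOver S} {f : T ⟶ S} {G : A'.X.left ⟶ A.X.left}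

/-- **A square `(G, f) : X' → X` over `T → S` is cartesian if its base change along an fpqc covering `c : T' → T` is**
(`(X' ×_T T' → X') ≫ G` over `T' → S` cartesian): the comparison `e : X' → X ×_S T` over `T` becomes an isomorphism
after the base change `T' → T` (both `X' ×_T T'` and `(X ×_S T) ×_T T'` are `X ×_S T'`), and «isomorphism» descends
along flat surjective quasi-compact morphisms (Mathlib `descendsAlong_isomorphisms_surjective_inf_flat_inf_quasicompact`).
[cite: StacksProject, Tag 02L4 (Descent, Lemma 35.23.19)] [cite: GortzWedhorn2020, Prop. 4.16 (p. 101)] -/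
theorem isPullback_of_flat_surjective (w : G ≫ A.X.hom = A'.X.hom ≫ f)
    (h : IsPullback (pullback.fst A'.X.hom c ≫ G) (pullback.snd A'.X.hom c) A.X.hom (c ≫ f)) :
    IsPullback G A'.X.hom A.X.hom f := by
  -- the comparison `e : X' → X₂ := X ×_S T` over `T`, and its base change `e'` along `c`
  let π₂ := pullback.snd A.X.hom f
  let e : A'.X.left ⟶ pullback A.X.hom f := pullback.lift G A'.X.hom w
  have heπ : e ≫ π₂ = A'.X.hom := pullback.lift_snd _ _ _
  have heA : e ≫ pullback.fst A.X.hom f = G := pullback.lift_fst _ _ _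
  let q := pullback.fst π₂ c
  let e' : pullback A'.X.hom c ⟶ pullback π₂ c :=
    pullback.lift (pullback.fst A'.X.hom c ≫ e) (pullback.snd A'.X.hom c)
      (by rw [Category.assoc, heπ]; exact pullback.condition)
  have he'q : e' ≫ q = pullback.fst A'.X.hom c ≫ e := pullback.lift_fst _ _ _
  have he's : e' ≫ pullback.snd π₂ c = pullback.snd A'.X.hom c := pullback.lift_snd _ _ _
  -- the square `(e', e)` over `q` is cartesian (both rectangles down to `T' → T` are)
  have sq : IsPullback e' (pullback.fst A'.X.hom c) q e := by
    refine IsPullback.of_right (h₁₂ := pullback.snd π₂ c) (v₁₃ := c) (h₂₂ := π₂) ?_ he'q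
      (IsPullback.of_hasPullback π₂ c).flip
    rw [he's, heπ]
    exact (IsPullback.of_hasPullback A'.X.hom c).flip
  -- `e'` is an isomorphism: source and target are both `X ×_S T'`
  have hX : IsPullback (q ≫ pullback.fst A.X.hom f) (pullback.snd π₂ c) A.X.hom (c ≫ f) :=
    (IsPullback.of_hasPullback π₂ c).paste_horiz (IsPullback.of_hasPullback A.X.hom f)
  have he' : e' = (h.isoIsPullback _ _ hX).hom := by
    apply hX.hom_ext
    · rw [IsPullback.isoIsPullback_hom_fst, ← Category.assoc, he'q, Category.assoc, heA]
    · rw [IsPullback.isoIsPullback_hom_snd, he's]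
  haveI : IsIso e' := by rw [he']; infer_instance
  -- descend
  have hiso : (MorphismProperty.isomorphisms Scheme.{u}) e :=
    MorphismProperty.of_isPullback_of_descendsAlong (P := MorphismProperty.isomorphisms Scheme.{u})
      (Q := @Surjective ⊓ @Flat ⊓ @QuasiCompact) sq ⟨⟨inferInstance, inferInstance⟩, inferInstance⟩
      ((MorphismProperty.isomorphisms.iff _).mpr inferInstance)
  haveI : IsIso e := (MorphismProperty.isomorphisms.iff _).mp hiso
  exact IsPullback.of_iso_pullback ⟨w⟩ (asIso e) heA heπ

/-- **★ `AbelianSchemeOver.IsBaseChangeVia` IS fpqc-LOCAL ON THE BASE `T`**: if for an fpqc covering `c : T' → T` the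
restriction `A' ×_T T'` (★ `baseChange c`) is the base change of `A` along `T' → T → S` via `(X' ×_T T' → X') ≫ G` AS
GROUP SCHEMES, then `G` exhibits `A'` as the base change of `A` along `f` as group schemes.  The square commutes (after
the epimorphism `X' ×_T T' → X'`) and is cartesian (`isPullback_of_flat_surjective`); the comparison
`e : X' ≅ X ×_S T` over `T` is a homomorphism fpqc-locally on `T` (★ `isBaseChangeVia_id_of_comp_eq`, ★
`isMonHom_of_isBaseChangeVia_id`), hence a homomorphism (`isMonHom_of_flat_surjective`), and `G = e ≫ pr_X` inherits
the unit / law clauses (★ `isBaseChangeVia_id_of_isMonHom`, ★ `IsBaseChangeVia.trans`). [cite: GortzWedhorn2020, Thm. 14.72]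
[cite: GortzWedhorn2020, Section (4.15) (p. 116) and Definition 4.42 (p. 116)] [cite: MumfordFogartyKirwan1994, Ch. 7 §2 Definition 7.2 (p. 129)] -/
theorem isBaseChangeVia_of_flat_surjective
    (h : (A'.baseChange c).IsBaseChangeVia A (c ≫ f) (pullback.fst A'.X.hom c ≫ G)) :
    A'.IsBaseChangeVia A f G := by
  -- the square commutes: test after the epimorphism `X' ×_T T' → X'`
  have w : G ≫ A.X.hom = A'.X.hom ≫ f := by
    obtain ⟨wc, -⟩ := h
    rw [← cancel_epi (pullback.fst A'.X.hom c), ← Category.assoc, wc]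
    exact (pullback.condition_assoc _).symm
  -- the square is cartesian
  have hpb : IsPullback G A'.X.hom A.X.hom f := isPullback_of_flat_surjective c w h.choose_spec.1
  -- the comparison isomorphism `e : X' ≅ X ×_S T` over `T`
  let e : A'.X ≅ (A.baseChange f).X := Over.isoMk hpb.isoPullback (hpb.isoPullback_hom_snd)
  have he : e.hom.left ≫ pullback.fst A.X.hom f = G := hpb.isoPullback_hom_fst
  -- `e` is a homomorphism: fpqc-locally on `T`
  haveI : IsMonHom e.hom := by
    refine isMonHom_of_flat_surjective c A' (A.baseChange f) e.hom
      (isMonHom_of_isBaseChangeVia_id (A₁ := (A.baseChange f).baseChange c) (A₂ := A'.baseChange c)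
        ((Over.pullback c).map e.hom) ?_)
    have h₁ : ((A.baseChange f).baseChange c).IsBaseChangeVia A (c ≫ f)
        (pullback.fst (A.baseChange f).X.hom c ≫ pullback.fst A.X.hom f) :=
      ((A.baseChange f).baseChange_isBaseChangeVia c).trans (A.baseChange_isBaseChangeVia f)
    haveI : IsIso ((Over.pullback c).map e.hom).left :=
      ((Over.forget _).mapIso ((Over.pullback c).mapIso e)).isIso_hom
    refine isBaseChangeVia_id_of_comp_eq h₁ h _ ?_ (Over.w _)
    have hc : ((Over.pullback c).map e.hom).left ≫ pullback.fst (A.baseChange f).X.hom c =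
        pullback.fst A'.X.hom c ≫ e.hom.left := by
      simp only [Over.pullback_map_left]
      erw [pullback.lift_fst]
    rw [← Category.assoc, hc, Category.assoc, he]
  -- conclude: `G = e ≫ pr_X` relates `A'` to `A` along `𝟙 T ≫ f`
  have hid : A'.IsBaseChangeVia (A.baseChange f) (𝟙 T) e.hom.left := isBaseChangeVia_id_of_isMonHom A' (A.baseChange f) e.hom
  have h' := hid.trans (A.baseChange_isBaseChangeVia f)
  rw [Category.id_comp, he] at h'
  exact h'

/-! ### §2 … with level structures -/

namespace LevelStructure

variable {g₀ n : ℕ} {φ' : A'.LevelStructure g₀ n} {φ : A.LevelStructure g₀ n}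

/-- **★ `LevelStructure.IsBaseChangeVia` is fpqc-local on `T`**: the group-scheme clause by §1, the section clauses
`σ'ᵢ ≫ G = f ≫ σᵢ` after the epimorphism `c` (★ `hom_ext_of_fpqc`; the restricted sections are `(σ' ×_T T') ≫ pr = c ≫ σ'`,
★ `sectionBaseChange_left_comp_fst`). [cite: MumfordFogartyKirwan1994, Ch. 7 §2 Definition 7.2 (p. 129)] [cite: GortzWedhorn2020, Thm. 14.72] -/
theorem isBaseChangeVia_of_flat_surjective
    (h : (φ'.baseChange c).IsBaseChangeVia φ (c ≫ f) (pullback.fst A'.X.hom c ≫ G)) :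
    φ'.IsBaseChangeVia φ f G := by
  refine ⟨AbelianSchemeOver.isBaseChangeVia_of_flat_surjective c h.1, fun j => ?_⟩
  refine hom_ext_of_fpqc c ?_
  have e := h.2 j
  rw [baseChange_σ, ← Category.assoc, sectionBaseChange_left_comp_fst, Category.assoc] at e
  exact e

end LevelStructure

end AbelianSchemeOver

/-! ### §3 Triples: all five clauses are fpqc-local on `T` -/

namespace PolarizedAbelianSchemeWithLevel

open AbelianSchemeOver

variable {g N : ℕ} {δ : Fin g → ℕ} {S T T' : Scheme.{u}} {P' : PolarizedAbelianSchemeWithLevel g N δ T}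
  {P : PolarizedAbelianSchemeWithLevel g N δ S} {f : T ⟶ S}
  {G : P'.A.X.left ⟶ P.A.X.left} {Ĝ : P'.D.hat.X.left ⟶ P.D.hat.X.left}

/-- **★ `PolarizedAbelianSchemeWithLevel.IsBaseChangeVia` IS fpqc-LOCAL ON THE BASE `T`** (`T` locally Noetherian).
If for a flat surjective quasi-compact `c : T' → T` the restricted triple `P'|_{T'}` (★ `baseChange c`) is the pull-back of
`P` along `T' → T → S` via the restricted maps `(X' ×_T T' → X') ≫ G`, `(X̂' ×_T T' → X̂') ≫ Ĝ`, then `(G, Ĝ)` exhibits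
`P'` as the pull-back of `P` along `f`.  Level clause §2, dual clause §1, `λ' ≫ Ĝ = G ≫ λ` after the epimorphism
`X' ×_T T' → X'` (★ `Polarization.baseChange_lam_left_comp_fst`); POINCARÉ: `(G × Ĝ)^*𝒫` (rigidified, ★
`nonempty_pullback_unitSection_pullback_map_P_iso`) and `𝒫'` (★ `selfBundle`) become isomorphic after the flat surjective
quasi-compact base change `X̂' ×_T T' → X̂'` (the restricted Poincaré clause, transported along ★
`prodBaseChangeToProd_comp_pullback_map` / ★ `exists_comp_prodBaseChangeToProd_eq_prodMap`), hence are isomorphic — ★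
(u6b) `RigidifiedLineBundle.nonempty_iso_of_pullback_prodMap_of_quasiCompact` ([MumfordAV1970] §13: rigidified fpqc
descent of trivialisations). [cite: MumfordFogartyKirwan1994, Ch. 7 §2 Definition 7.2 (p. 129)] [cite: GortzWedhorn2020, Thm. 14.72]
[cite: MumfordAV1970, §13 (p. 125), §15 Thm. 1 (p. 143)] -/
theorem isBaseChangeVia_of_flat_surjective [IsLocallyNoetherian T] (c : T' ⟶ T) [Flat c] [Surjective c] [QuasiCompact c]
    (h : (P'.baseChange c).IsBaseChangeVia P (c ≫ f)
      (pullback.fst P'.A.X.hom c ≫ G) (pullback.fst P'.D.hat.X.hom c ≫ Ĝ)) :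
    P'.IsBaseChangeVia P f G Ĝ := by
  have hlev : P'.level.IsBaseChangeVia P.level f G :=
    LevelStructure.isBaseChangeVia_of_flat_surjective c h.1
  have hhat : P'.D.hat.IsBaseChangeVia P.D.hat f Ĝ :=
    AbelianSchemeOver.isBaseChangeVia_of_flat_surjective c h.2.1
  obtain ⟨w, -, hη, -⟩ := hlev.1
  obtain ⟨wh, -⟩ := id hhat
  refine ⟨hlev, hhat, ⟨w.symm, wh.symm, ?_⟩, ?_⟩
  · -- the Poincaré clause, by rigidified fpqc descent on `X'_{X̂'}` along `X̂' ×_T T' → X̂'`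
    let m := pullback.map P'.A.X.hom P'.D.hat.X.hom P.A.X.hom P.D.hat.X.hom G Ĝ f w.symm wh.symm
    let M₁ : P'.A.RigidifiedLineBundle P'.D.hat.X.hom :=
      ⟨(Scheme.Modules.pullback m).obj P.D.P, Literature.AlgebraicGeometry.Modules.hasRank_pullback m P.D.hasRank_one,
        nonempty_pullback_unitSection_pullback_map_P_iso hη w.symm wh.symm⟩
    obtain ⟨e₀⟩ := RigidifiedLineBundle.nonempty_iso_of_pullback_prodMap_of_quasiCompact (P'.D.hat.X.hom)
      (pullback.fst P'.D.hat.X.hom c) M₁ (DualPair.selfBundle P'.D) (by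
        -- the restricted Poincaré clause, read on `(X' ×_T T') ×_{T'} (X̂' ×_T T')`
        obtain ⟨wGc, wĜc, ⟨φ⟩⟩ := h.2.2.1
        have E := prodBaseChangeToProd_comp_pullback_map c w.symm wh.symm wGc wĜc
        let isoρ : (Scheme.Modules.pullback (P'.D.prodBaseChangeToProd c)).obj M₁.L ≅
            (Scheme.Modules.pullback (P'.D.prodBaseChangeToProd c)).obj P'.D.P :=
          (Scheme.Modules.pullbackComp _ _).app _ ≪≫ (Scheme.Modules.pullbackCongr E).app _ ≪≫ φ
        -- transported to `X' ×_T (X̂' ×_T T')`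
        obtain ⟨σ, hσ⟩ := exists_comp_prodBaseChangeToProd_eq_prodMap (P' := P') T' c
        exact ⟨(Scheme.Modules.pullbackCongr hσ.symm).app _ ≪≫ ((Scheme.Modules.pullbackComp _ _).app _).symm ≪≫
          (Scheme.Modules.pullback σ).mapIso isoρ ≪≫ (Scheme.Modules.pullbackComp _ _).app _ ≪≫
          (Scheme.Modules.pullbackCongr hσ).app _⟩)
    exact ⟨e₀⟩
  · -- the `λ`-clause, after the epimorphism `X' ×_T T' → X'`
    rw [← cancel_epi (pullback.fst P'.A.X.hom c)]
    have e := h.2.2.2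
    change (P'.pol.baseChange c).lam.left ≫ pullback.fst P'.D.hat.X.hom c ≫ Ĝ =
      (pullback.fst P'.A.X.hom c ≫ G) ≫ P.pol.lam.left at e
    rw [← Category.assoc, Polarization.baseChange_lam_left_comp_fst, Category.assoc, Category.assoc] at e
    exact e

end PolarizedAbelianSchemeWithLevel

end Literature.AlgebraicGeometry.AbelianSchemes

end
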